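import Summits.CriticalPhenomena.PercolationContinuityZ3.Theorems.PercNearOneGluingNoHeavyQuantDepthTwoRelayRow
import Summits.CriticalPhenomena.PercolationContinuityZ3.Theorems.PercNearOneGluingNoHeavyQuantDepthOneRows
import HarnessLib

/-!
# QUANT lane R8, depth-2 closure (D2) in the RELAY case: THE ONE-ROW LEMMA, part 3 — the threshold-zero rows: the `LawDec.TLC` row `(j, 0)` of
# (relay_g) ∗ μ at target `T + g` from ONE scaled single-threshold row `θ₀ · TLCR_T(j*, 0)` of the factor

builds on p205010 (kernel theorem, internal audit signed; external expert review pending)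

Support file (`--supports stmt-CriticalPhenomena-4575`), QUANT lane seat prim-quant-census-2 (gen 67); census memo
`run/shared/lean/prim/quant/prim-quant-census-2-g67/DEPTH2-CLOSURE-G67.md` §4b (i = 0 rows: 339/339 regime-R instances).  Theorems only, standard axioms, no sorries.
Same skeleton as parts 1–2 (`…QuantDepthTwoRelayRowPointwise`, `…QuantDepthTwoRelayRow`): the pull-back of the product row `(j, 0)` is dominated coefficientwise by
`θ₀` times the factor's single-threshold row `(j*, 0)` (`θ₀ = min(1−g, T/(T+g))`, `j* = j` / `j − 1` by the cheap-mid rule), the mids by `relay_cap_pairGate` /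
`relay_cap_pairGate_top` at `i = 0`; the hypothesis is ONE row of `LawDec.TLC y T M μ` (census-2 g64).  HONEST STATUS: D2, G₁, `Quant.FarTreeRow` (light) remain OPEN;
nothing here is cited as a published result; the lane's RATE class log\* and honest sentence are unchanged.

[this work]; the gluing rows served [cite: KozmaNitzan2024, Conjecture 3 (p. 15)]; product measure [cite: Grimmett1999, §1.3 p. 10].
-/

noncomputable section

namespace Summit.CriticalPhenomena.PercolationContinuityZ3.Theorems

namespace Quant

open Finset

namespace LawDec

set_option maxHeartbeats 400000 in
/-- **POINTWISE, threshold zero** (`js ∈ {j, j−1}` encoded by `hjs`): for every `a`,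
`(1−g)·C′(a) + g·C′(a+1) ≤ θ₀·C⁰(a)` where `C′` is the product row `(j, 0)` at `T+g` and `C⁰` the factor single-threshold row `(js, 0)` at `T`. [this work] -/
theorem relay_pointwise_zero (y T g : ℝ) (j js : ℕ) (Cp Cf : ℕ → ℝ)
    (hy0 : 0 < y) (hy1 : y < 1) (hyg : y ≤ g) (hg1 : g ≤ 1) (hT : 0 < T)
    (hjs : (js = j ∧ (T + g < (j : ℝ) → y / (1 - y) ≤ usage y (T + g) j 0 j)) ∨ (js + 1 = j ∧ T + g < (j : ℝ) ∧ usage y (T + g) j 0 j ≤ y / (1 - y)))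
    (hCp : ∀ h : ℕ, Cp h = y / (1 - y) * (if h ≤ 0 then (1 : ℝ) else 0) - (if j + 1 ≤ h then (1 : ℝ) else 0)
      - y / (1 - y) * (if h ≤ j ∧ T + g < ((0 : ℕ) : ℝ) + h then 1 / usage y (T + g) j 0 h else 0))
    (hCf : ∀ a : ℕ, Cf a = y / (1 - y) * (if a ≤ 0 then (1 : ℝ) else 0) - (if js + 1 ≤ a then (1 : ℝ) else 0)
      - y / (1 - y) * (if a ≤ js ∧ T < ((0 : ℕ) : ℝ) + a then 1 / usage y T js 0 a else 0))
    (a : ℕ) : (1 - g) * Cp a + g * Cp (a + 1) ≤ min (1 - g) (T / (T + g)) * Cf a := by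
  have h1y : 0 < 1 - y := by linarith
  have hu0 : 0 < y / (1 - y) := div_pos hy0 h1y
  set u : ℝ := y / (1 - y) with hu
  have hg0 : 0 < g := lt_of_lt_of_le hy0 hyg
  have h1g : 0 ≤ 1 - g := by linarith
  have hA : 0 < T + g := by linarith
  have hθ0 : 0 ≤ min (1 - g) (T / (T + g)) := le_min h1g (div_pos hT hA).le
  have hθ1 : min (1 - g) (T / (T + g)) ≤ 1 := le_trans (min_le_left _ _) (by linarith)
  have hlow : 2 * ((0 : ℕ) : ℝ) < T := by push_cast; linarith
  have hjsle : js ≤ j := by rcases hjs with ⟨h, _⟩ | ⟨h, _⟩ <;> omega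
  rcases Nat.eq_zero_or_pos a with ha0 | ha0
  · -- a = 0: the top (and only) low
    subst ha0
    have hCp0 : Cp 0 = u := by
      rw [hCp 0, if_pos le_rfl, if_neg (by omega)]
      have : ¬ (0 ≤ j ∧ T + g < ((0 : ℕ) : ℝ) + ((0 : ℕ) : ℝ)) := by rintro ⟨_, h2⟩; push_cast at h2; linarith
      rw [if_neg this]; ring
    have hCf0 : Cf 0 = u := by
      rw [hCf 0, if_pos le_rfl, if_neg (by omega)]
      have : ¬ (0 ≤ js ∧ T < ((0 : ℕ) : ℝ) + ((0 : ℕ) : ℝ)) := by rintro ⟨_, h2⟩; push_cast at h2; linarith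
      rw [if_neg this]; ring
    rw [hCp0, hCf0]
    by_cases hj0 : j + 1 ≤ 0 + 1
    · -- j = 0: atom 1 is a giant of the product row
      have hCp1 : Cp (0 + 1) = -1 := by
        rw [hCp (0 + 1), if_neg (by omega), if_pos hj0]
        have : ¬ (0 + 1 ≤ j ∧ T + g < ((0 : ℕ) : ℝ) + ((0 + 1 : ℕ) : ℝ)) := by rintro ⟨h, _⟩; omega
        rw [if_neg this]; ring
      rw [hCp1]
      have hmin1 : (1 - g) * u + g * (-1) ≤ (1 - g) * u := by nlinarith
      have hmin2 : (1 - g) * u + g * (-1) ≤ T / (T + g) * u := by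
        rw [show T / (T + g) * u = u - g * (u / (T + g)) by field_simp; ring]
        have hk : u / (T + g) ≤ u + 1 := by
          rw [div_le_iff₀ hA]
          have hu1 : u * (1 - y) = y := by rw [hu]; field_simp
          nlinarith [mul_nonneg hu0.le hA.le]
        have hk' := mul_le_mul_of_nonneg_left hk hg0.le
        linarith
      rcases min_cases (1 - g) (T / (T + g)) with ⟨hm, _⟩ | ⟨hm, _⟩ <;> rw [hm] <;> linarith [hmin1, hmin2]
    · have hj1 : 0 + 1 ≤ j := by omega
      by_cases hc : T + g < ((0 : ℕ) : ℝ) + ((0 + 1 : ℕ) : ℝ)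
      · -- compatible mid 1 at the raised target
        have hc' : T + g < 1 := by push_cast at hc; linarith
        have hG : pairGate y (T + g) 0 (0 + 1) = T + g := by
          unfold pairGate
          have e : (T + g - 2 * ((0 : ℕ) : ℝ)) / (((0 + 1 : ℕ) : ℝ) - ((0 : ℕ) : ℝ)) = T + g := by push_cast; ring
          rw [e]
          exact BlobDec2.gate_eq_heavy y (T + g) hy0.le (by linarith)
        have hCp1 : Cp (0 + 1) = -(u * (1 / (T + g) - 1)) := by
          rw [hCp (0 + 1), if_neg (by omega), if_neg hj0, if_pos ⟨hj1, hc⟩,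
            one_div_usage_of_le_layer y (T + g) j 0 (0 + 1) hj1 (by rw [hG]; exact hA.ne'), hG]
          ring
        rw [hCp1]
        have hval : (1 - g) * u + g * -(u * (1 / (T + g) - 1)) = T / (T + g) * u := by
          field_simp
          ring
        rw [hval]
        have hle : T / (T + g) ≤ 1 - g := by rw [div_le_iff₀ hA]; nlinarith
        rw [min_eq_right hle]
      · have hCp1 : Cp (0 + 1) = 0 := by
          rw [hCp (0 + 1), if_neg (by omega), if_neg hj0]
          have : ¬ (0 + 1 ≤ j ∧ T + g < ((0 : ℕ) : ℝ) + ((0 + 1 : ℕ) : ℝ)) := fun h => hc h.2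
          rw [if_neg this]; ring
        rw [hCp1]
        have hsg1 : 1 ≤ T + g := by push_cast at hc; linarith
        have hle : 1 - g ≤ T / (T + g) := by rw [le_div_iff₀ hA]; nlinarith
        rw [min_eq_left hle]
        linarith
  · -- a ≥ 1
    have ha' : (0 : ℝ) < a := by exact_mod_cast ha0
    -- clipped capacities of the pull-back
    set X0 : ℝ := max 0 (1 / pairGate y (T + g) 0 a - 1) with hX0
    set X1 : ℝ := max 0 (1 / pairGate y (T + g) 0 (a + 1) - 1) with hX1
    have hX0n : 0 ≤ X0 := le_max_left _ _
    have hX1n : 0 ≤ X1 := le_max_left _ _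
    rcases Nat.lt_or_ge j a with hja | haj
    · -- giants of the product: a ≥ j + 1
      have hCpa : Cp a = -1 := by
        rw [hCp a, if_neg (by omega), if_pos (by omega)]
        have : ¬ (a ≤ j ∧ T + g < ((0 : ℕ) : ℝ) + a) := by rintro ⟨h, _⟩; omega
        rw [if_neg this]; ring
      have hCpa1 : Cp (a + 1) = -1 := by
        rw [hCp (a + 1), if_neg (by omega), if_pos (by omega)]
        have : ¬ (a + 1 ≤ j ∧ T + g < ((0 : ℕ) : ℝ) + ((a + 1 : ℕ) : ℝ)) := by rintro ⟨h, _⟩; omega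
        rw [if_neg this]; ring
      have hCfa : Cf a = -1 := by
        rw [hCf a, if_neg (by omega), if_pos (by omega)]
        have : ¬ (a ≤ js ∧ T < ((0 : ℕ) : ℝ) + a) := by rintro ⟨h, _⟩; omega
        rw [if_neg this]; ring
      rw [hCpa, hCpa1, hCfa]; nlinarith
    · -- a ≤ j: a mid of the product; Cp a = -u X0
      have hCpa : Cp a = -(u * X0) := by
        rw [hCp a, if_neg (by omega), if_neg (by omega)]
        by_cases hc : T + g < ((0 : ℕ) : ℝ) + a
        · rw [if_pos ⟨haj, hc⟩, one_div_usage_eq_cap y (T + g) j 0 a hy0 hy1 haj (by push_cast; linarith) hc]; ring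
        · rw [if_neg (fun h => hc h.2), hX0, cap_clip_eq_zero y (T + g) 0 a ha0 hc]; ring
      rcases hjs with ⟨hjsj, hexp⟩ | ⟨hjs1, hcomp, hcheap⟩
      · -- same layer js = j
        subst hjsj
        have hCfa : Cf a = -(u * (if T < ((0 : ℕ) : ℝ) + a then 1 / usage y T js 0 a else 0)) := by
          rw [hCf a, if_neg (by omega), if_neg (by omega)]
          by_cases hc : T < ((0 : ℕ) : ℝ) + a
          · rw [if_pos ⟨haj, hc⟩, if_pos hc]; ring
          · rw [if_neg (fun h => hc h.2), if_neg hc]; ring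
        rcases haj.lt_or_eq with hajlt | hajeq
        · -- interior mid: a + 1 ≤ j
          have hCpa1 : Cp (a + 1) = -(u * X1) := by
            rw [hCp (a + 1), if_neg (by omega), if_neg (by omega)]
            by_cases hc : T + g < ((0 : ℕ) : ℝ) + ((a + 1 : ℕ) : ℝ)
            · rw [if_pos ⟨by omega, hc⟩, one_div_usage_eq_cap y (T + g) js 0 (a + 1) hy0 hy1 (by omega) (by push_cast; linarith) hc]; ring
            · rw [if_neg (fun h => hc h.2), hX1, cap_clip_eq_zero y (T + g) 0 (a + 1) (by omega) hc]; ring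
          rw [hCpa, hCpa1, hCfa]
          suffices hkey : min (1 - g) (T / (T + g)) * (if T < ((0 : ℕ) : ℝ) + a then 1 / usage y T js 0 a else 0) ≤ (1 - g) * X0 + g * X1 by
            nlinarith [mul_le_mul_of_nonneg_left hkey hu0.le]
          split_ifs with hc
          · rw [one_div_usage_eq_cap y T js 0 a hy0 hy1 haj hlow hc]
            have := relay_cap_pairGate y T g 0 a hy0 hy1 hyg hg1 hlow hc
            have e : (T - 2 * ((0 : ℕ) : ℝ)) / (T - 2 * ((0 : ℕ) : ℝ) + g) = T / (T + g) := by push_cast; ring_nf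
            rw [e] at this
            exact this
          · nlinarith
        · -- endpoint a = j, pair not cheap
          subst hajeq
          have hCpa1 : Cp (a + 1) = -1 := by
            rw [hCp (a + 1), if_neg (by omega), if_pos le_rfl]
            have : ¬ (a + 1 ≤ a ∧ T + g < ((0 : ℕ) : ℝ) + ((a + 1 : ℕ) : ℝ)) := by rintro ⟨h, _⟩; omega
            rw [if_neg this]; ring
          rw [hCpa, hCpa1, hCfa]
          have hρtop : y ≤ (T + g - 2 * ((0 : ℕ) : ℝ)) / ((a : ℝ) - ((0 : ℕ) : ℝ)) := by
            by_cases hc : T + g < ((0 : ℕ) : ℝ) + a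
            · have hG1 : pairGate y (T + g) 0 a < 1 := pairGate_lt_one y (T + g) 0 a hy0 hy1 (by push_cast; linarith) hc
              exact rho_ge_of_pairGate_ge y (T + g) 0 a hy1 (pairGate_ge_of_usage_ge y (T + g) a 0 a hy1 le_rfl hG1 (hexp (by push_cast at hc; linarith)))
            · push_cast at hc ⊢
              rw [le_div_iff₀ (by linarith)]; nlinarith
          have hug : g * (-1 : ℝ) = -(u * (g * ((1 - y) / y))) := by rw [hu]; field_simp
          suffices hkey : min (1 - g) (T / (T + g)) * (if T < ((0 : ℕ) : ℝ) + a then 1 / usage y T a 0 a else 0) ≤ (1 - g) * X0 + g * ((1 - y) / y) by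
            rw [hug]; nlinarith [mul_le_mul_of_nonneg_left hkey hu0.le]
          split_ifs with hc
          · rw [one_div_usage_eq_cap y T a 0 a hy0 hy1 le_rfl hlow hc]
            have := relay_cap_pairGate_top y T g 0 a hy0 hy1 hyg hg1 hlow hc hρtop
            have e : (T - 2 * ((0 : ℕ) : ℝ)) / (T - 2 * ((0 : ℕ) : ℝ) + g) = T / (T + g) := by push_cast; ring_nf
            rw [e] at this
            exact this
          · nlinarith [div_nonneg h1y.le hy0.le]
      · -- lower layer js + 1 = j (cheap pair (0, j))
        rcases haj.lt_or_eq with hajlt | hajeq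
        · -- interior: a ≤ js
          have hajs : a ≤ js := by omega
          have hCfa : Cf a = -(u * (if T < ((0 : ℕ) : ℝ) + a then 1 / usage y T js 0 a else 0)) := by
            rw [hCf a, if_neg (by omega), if_neg (by omega)]
            by_cases hc : T < ((0 : ℕ) : ℝ) + a
            · rw [if_pos ⟨hajs, hc⟩, if_pos hc]; ring
            · rw [if_neg (fun h => hc h.2), if_neg hc]; ring
          have hCpa1 : Cp (a + 1) = -(u * X1) := by
            rw [hCp (a + 1), if_neg (by omega), if_neg (by omega)]
            by_cases hc : T + g < ((0 : ℕ) : ℝ) + ((a + 1 : ℕ) : ℝ)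
            · rw [if_pos ⟨by omega, hc⟩, one_div_usage_eq_cap y (T + g) j 0 (a + 1) hy0 hy1 (by omega) (by push_cast; linarith) hc]; ring
            · rw [if_neg (fun h => hc h.2), hX1, cap_clip_eq_zero y (T + g) 0 (a + 1) (by omega) hc]; ring
          rw [hCpa, hCpa1, hCfa]
          suffices hkey : min (1 - g) (T / (T + g)) * (if T < ((0 : ℕ) : ℝ) + a then 1 / usage y T js 0 a else 0) ≤ (1 - g) * X0 + g * X1 by
            nlinarith [mul_le_mul_of_nonneg_left hkey hu0.le]
          split_ifs with hc
          · rw [one_div_usage_eq_cap y T js 0 a hy0 hy1 hajs hlow hc]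
            have := relay_cap_pairGate y T g 0 a hy0 hy1 hyg hg1 hlow hc
            have e : (T - 2 * ((0 : ℕ) : ℝ)) / (T - 2 * ((0 : ℕ) : ℝ) + g) = T / (T + g) := by push_cast; ring_nf
            rw [e] at this
            exact this
          · nlinarith
        · -- a = j: a giant of the factor row, the cheap product mid
          subst hajeq
          have hCpa1 : Cp (a + 1) = -1 := by
            rw [hCp (a + 1), if_neg (by omega), if_pos le_rfl]
            have : ¬ (a + 1 ≤ a ∧ T + g < ((0 : ℕ) : ℝ) + ((a + 1 : ℕ) : ℝ)) := by rintro ⟨h, _⟩; omega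
            rw [if_neg this]; ring
          have hCfa : Cf a = -1 := by
            rw [hCf a, if_neg (by omega), if_pos (by omega)]
            have : ¬ (a ≤ js ∧ T < ((0 : ℕ) : ℝ) + a) := by rintro ⟨h, _⟩; omega
            rw [if_neg this]; ring
          have hX : (1 - y) / y ≤ 1 / usage y (T + g) a 0 a :=
            one_div_usage_ge_of_usage_le y (T + g) a 0 a hy0 hy1 (by push_cast; linarith) (by push_cast at hcomp ⊢; linarith) hcheap
          have hCpa' : Cp a = -(u * (1 / usage y (T + g) a 0 a)) := by
            rw [hCp a, if_neg (by omega), if_neg (by omega), if_pos ⟨le_rfl, by push_cast at hcomp ⊢; linarith⟩]; ring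
          rw [hCpa', hCpa1, hCfa]
          set P : ℝ := 1 / usage y (T + g) a 0 a with hP
          clear_value P
          have hprod : 1 ≤ u * P := by
            have e : u * ((1 - y) / y) = 1 := by rw [hu]; field_simp
            calc (1 : ℝ) = u * ((1 - y) / y) := e.symm
              _ ≤ u * P := mul_le_mul_of_nonneg_left hX hu0.le
          have h' : (1 - g) * 1 ≤ (1 - g) * (u * P) := mul_le_mul_of_nonneg_left hprod h1g
          have e2 : (1 - g) * -(u * P) + g * -1 = -((1 - g) * (u * P)) - g := by ring
          rw [e2]
          have h'' : 1 - g ≤ (1 - g) * (u * P) := by linarith [h']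
          have hm1 : min (1 - g) (T / (T + g)) * (-1 : ℝ) = -min (1 - g) (T / (T + g)) := by ring
          rw [hm1]
          linarith [h'', hθ1]

/-- **THE ONE-ROW RELAY LEMMA, threshold zero, row-family form.**  `0 < y < 1`, `y ≤ g ≤ 1`, `μ ≥ 0` with `TLC y T M μ` (the single-threshold rows of census-2 g64), `0 < T`,
a product layer `j ≤ M` with the layer-case hypothesis as in `relayConv_tlcRow_of_tlc2`.  Then `ν = lconv M 1 μ {0: 1−g, 1: g}` satisfies the body of the `LawDec.TLC` row
`(j, 0)` at `(y, T + g, M + 1)`. [this work] -/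
theorem relayConv_tlcRowZero_of_tlc (y T g : ℝ) (M j : ℕ) (μ : ℕ → ℝ)
    (hy0 : 0 < y) (hy1 : y < 1) (hyg : y ≤ g) (hg1 : g ≤ 1) (hμ0 : ∀ h, 0 ≤ μ h) (hT1 : TLC y T M μ) (hT : 0 < T) (hjM : j ≤ M)
    (hcase : (j < M ∧ (T + g < (j : ℝ) → y / (1 - y) ≤ usage y (T + g) j 0 j))
      ∨ (T + g < (j : ℝ) ∧ usage y (T + g) j 0 j ≤ y / (1 - y))) :
    y / (1 - y) * ∑ l ∈ Finset.range (0 + 1), lconv M 1 μ (fun h => if h = 1 then g else if h = 0 then 1 - g else 0) l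
      ≤ ∑ h ∈ Finset.range (M + 1 + 1), (if j + 1 ≤ h then lconv M 1 μ (fun h => if h = 1 then g else if h = 0 then 1 - g else 0) h else 0)
        + y / (1 - y) * ∑ h ∈ Finset.range (M + 1 + 1), (if h ≤ j ∧ T + g < ((0 : ℕ) : ℝ) + h then
            lconv M 1 μ (fun h => if h = 1 then g else if h = 0 then 1 - g else 0) h / usage y (T + g) j 0 h else 0) := by
  -- choose the factor layer js and the pointwise data
  have hjs : ∃ js : ℕ, js < M ∧ js ≤ j ∧
      ((js = j ∧ (T + g < (j : ℝ) → y / (1 - y) ≤ usage y (T + g) j 0 j)) ∨ (js + 1 = j ∧ T + g < (j : ℝ) ∧ usage y (T + g) j 0 j ≤ y / (1 - y))) := by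
    rcases hcase with ⟨hjM', hexp⟩ | ⟨hcomp, hcheap⟩
    · exact ⟨j, hjM', le_rfl, Or.inl ⟨rfl, hexp⟩⟩
    · have hj1 : 1 ≤ j := by
        by_contra h0
        have : j = 0 := by omega
        rw [this] at hcomp; push_cast at hcomp; linarith [lt_of_lt_of_le hy0 hyg]
      exact ⟨j - 1, by omega, by omega, Or.inr ⟨by omega, hcomp, hcheap⟩⟩
  obtain ⟨js, hjsM, hjsj, hjs⟩ := hjs
  set Cp : ℕ → ℝ := fun h => y / (1 - y) * (if h ≤ 0 then (1 : ℝ) else 0) - (if j + 1 ≤ h then (1 : ℝ) else 0)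
      - y / (1 - y) * (if h ≤ j ∧ T + g < ((0 : ℕ) : ℝ) + h then 1 / usage y (T + g) j 0 h else 0) with hCpdef
  set Cf : ℕ → ℝ := fun a => y / (1 - y) * (if a ≤ 0 then (1 : ℝ) else 0) - (if js + 1 ≤ a then (1 : ℝ) else 0)
      - y / (1 - y) * (if a ≤ js ∧ T < ((0 : ℕ) : ℝ) + a then 1 / usage y T js 0 a else 0) with hCfdef
  have hCp : ∀ h : ℕ, Cp h = y / (1 - y) * (if h ≤ 0 then (1 : ℝ) else 0) - (if j + 1 ≤ h then (1 : ℝ) else 0)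
      - y / (1 - y) * (if h ≤ j ∧ T + g < ((0 : ℕ) : ℝ) + h then 1 / usage y (T + g) j 0 h else 0) := fun h => rfl
  have hCf : ∀ a : ℕ, Cf a = y / (1 - y) * (if a ≤ 0 then (1 : ℝ) else 0) - (if js + 1 ≤ a then (1 : ℝ) else 0)
      - y / (1 - y) * (if a ≤ js ∧ T < ((0 : ℕ) : ℝ) + a then 1 / usage y T js 0 a else 0) := fun a => rfl
  -- the factor row (js, 0) in functional form: Σ μ a · Cf a ≤ 0
  have row := hT1 js 0 hjsM (by omega) (by push_cast; linarith)
  have hfun : ∑ a ∈ Finset.range (M + 1), μ a * Cf a ≤ 0 := by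
    have e1 : ∑ a ∈ Finset.range (M + 1), μ a * (y / (1 - y) * (if a ≤ 0 then (1 : ℝ) else 0))
        = y / (1 - y) * ∑ l ∈ Finset.range (0 + 1), μ l := by
      rw [sum_range_eq_sum_ite_of_le μ M 0 (by omega), Finset.mul_sum]
      exact Finset.sum_congr rfl fun a _ => by split_ifs <;> ring
    have e3 : ∑ a ∈ Finset.range (M + 1), μ a * (if js + 1 ≤ a then (1 : ℝ) else 0)
        = ∑ h ∈ Finset.range (M + 1), (if js + 1 ≤ h then μ h else 0) :=
      Finset.sum_congr rfl fun a _ => by split_ifs <;> ring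
    have e4 : ∑ a ∈ Finset.range (M + 1), μ a * (y / (1 - y) * (if a ≤ js ∧ T < ((0 : ℕ) : ℝ) + a then 1 / usage y T js 0 a else 0))
        = y / (1 - y) * ∑ h ∈ Finset.range (M + 1), (if h ≤ js ∧ T < ((0 : ℕ) : ℝ) + h then μ h / usage y T js 0 h else 0) := by
      rw [Finset.mul_sum]
      exact Finset.sum_congr rfl fun a _ => by split_ifs <;> ring
    have hsplit : ∑ a ∈ Finset.range (M + 1), μ a * Cf a
        = ∑ a ∈ Finset.range (M + 1), μ a * (y / (1 - y) * (if a ≤ 0 then (1 : ℝ) else 0))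
          - ∑ a ∈ Finset.range (M + 1), μ a * (if js + 1 ≤ a then (1 : ℝ) else 0)
          - ∑ a ∈ Finset.range (M + 1), μ a * (y / (1 - y) * (if a ≤ js ∧ T < ((0 : ℕ) : ℝ) + a then 1 / usage y T js 0 a else 0)) := by
      rw [← Finset.sum_sub_distrib, ← Finset.sum_sub_distrib]
      exact Finset.sum_congr rfl fun a _ => by rw [hCf a]; ring
    rw [hsplit, e1, e3, e4]
    linarith [row]
  -- pointwise domination and assembly
  have hθ0 : 0 ≤ min (1 - g) (T / (T + g)) := le_min (by linarith) (div_pos hT (by linarith [lt_of_lt_of_le hy0 hyg])).le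
  have key : ∀ a : ℕ, (1 - g) * Cp a + g * Cp (a + 1) ≤ min (1 - g) (T / (T + g)) * Cf a :=
    fun a => relay_pointwise_zero y T g j js Cp Cf hy0 hy1 hyg hg1 hT hjs hCp hCf a
  have hfunc : ∑ h ∈ Finset.range (M + 1 + 1), Cp h * lconv M 1 μ (fun h => if h = 1 then g else if h = 0 then 1 - g else 0) h ≤ 0 := by
    rw [sum_fun_mul_lconv_one]
    simp only [show ((0 : ℕ) = 1) = False from by simp, if_true, if_false]
    calc ∑ a ∈ Finset.range (M + 1), μ a * ((1 - g) * Cp a + g * Cp (a + 1))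
        ≤ ∑ a ∈ Finset.range (M + 1), μ a * (min (1 - g) (T / (T + g)) * Cf a) :=
          Finset.sum_le_sum fun a _ => mul_le_mul_of_nonneg_left (key a) (hμ0 a)
      _ = min (1 - g) (T / (T + g)) * ∑ a ∈ Finset.range (M + 1), μ a * Cf a := by
          rw [Finset.mul_sum]; exact Finset.sum_congr rfl fun a _ => by ring
      _ ≤ 0 := by nlinarith [mul_le_mul_of_nonneg_left hfun hθ0]
  exact tlcRow_of_functional y (T + g) (M + 1) 0 j _ (by omega) (by omega) hfunc

end LawDec

end Quant

end Summit.CriticalPhenomena.PercolationContinuityZ3.Theorems
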